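import Mathlib
import HarnessLib
import HarnessLib.Audit
import Summits.QuantumAdvantage.Statement
import Literature.Computability.Complexity.Randomized
import Literature.Computability.Complexity.ProbabilisticClasses
import Literature.Computability.Complexity.Oracle
import Literature.Computability.Complexity.ExpPadding
import Literature.Computability.Cryptography.ClassBQP
import Literature.Computability.Cryptography.OracleGames
import Literature.Computability.QuantumComplexity.Factoring
import HarnessLib.Audit.Status.Attr

/-!
Route: Refuters

DORMANT since 2026-08-22T21:43:40Z (reconciler: no traction for 5.7 d (last activity item-evidence-added at 2026-08-17T04:37:52Z); parked, not closed — `ledger route dormant route-QuantumAdvantage-Refuters --off` to reactivate) — unstaffed, not closed; items shared with open routes are served there. `ledger route dormant <id> --off` reactivates.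

Route QuantumAdvantage/Refuters (realises idea card constructive-advantage-refuters: "who finds the
hard inputs?").
Thesis X_B (CONSTRUCTIVE quantum advantage, level L2 between route AvgCase's ∃D∀M and the summit's
∀M∃x): some language L ∈ BQP admits a BPP-constructive separation from BPP in the sense of
Chen–Jin–Santhanam–Williams (FOCS 2021, Def. 1, BPP-refuters, i.o. form): for every BPP language L''
there is a probabilistic polynomial-time refuter R which, on input 1^n, for infinitely many n
outputs with probability ≥ 2/3 a string x of length n in the symmetric difference L Δ L'' (an input
on which the BPP algorithm presenting L'' errs). The refuter may depend on L'' (equivalently on the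
code of the refuted algorithm); quantifying over L'' ∈ BPP instead of over gap-everywhere PPT
machines is equivalent because such a machine errs on x iff x ∈ L Δ L(M).
It suffices to show X_B: a refuter against L'' := L would have to hit the empty set, so L ∉ BPP
(Assembly, one line, checked rc 0 in the planner sketch).
Lean (over existing decls, elaborates): ∃ L ∈ Literature.Computability.Cryptography.BQP, ∀ L'' ∈
Literature.Computability.Complexity.BPP, ∃ R : Literature.Computability.Complexity.RandAlg ℕ (List
Bool), R.IsPolyTime Computability.unaryEncodeNat id ∧ (∃ q : Polynomial ℕ, ∀ n, R.coinLen n = q.eval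
n) ∧ ∃ᶠ n in Filter.atTop, (2:ℝ)/3 ≤ R.pr Computability.unaryEncodeNat n {x | x.length = n ∧ (x ∈ L
↔ x ∉ L'')}

Rationale: WHY THIS LINE. X_B strengthens S by asking WHO finds the hard inputs: refuters (Kabanets 2000;
Gutfreund–Shaltiel–Ta-Shma doi:10.1007/s00037-007-0235-8; Chen–Jin–Santhanam–Williams
arXiv:2203.14379 = CJSW21) stratify BQP ⊄ BPP into L3 (∃ samplable D ∀M: route AvgCase) ⇒ L2 (∀ BPP
algorithm ∃ efficient refuter: this route) ⇒ L1 (∀M ∃x: the summit). CJSW21 Thm 1 proves "separation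
⇒ constructive separation" for NP, Σ_k, PP, ⊕P, PSPACE, EXP, NEXP, EXP^NP against P/ZPP/BPP, but its
engine (Thm 4: closure of the hard class under polynomially bounded ∃/∀, paddable complete sets;
GST-style self-reference) is unavailable for BQP — the quantum case is absent from print (read:
CJSW21 pp. 3–7, 18–22). Imported area: meta-complexity (refuters, padding/translation arguments,
abstract complexity à la Blum speed-up / Levin optimal search) + the tree's relativized BQP
diagonalization (OracleSeparationBQPBPP.lean, proved). The planner's analysis (NOTES.md §A–E) found
two engines and one obstruction that make the level L2 mathematically sharp:
(i) PINNING: if some language has randomized complexity 2^{Θ(n^a)} (upper bound via padLang a L ∈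
BPP, lower bound via the 2^{⌈n^a/k⌉}-padded language ∉ BPP) then its all-paddings language {1^t 0 x
: x ∈ L} is BPP-constructively separated (enumerate-and-check in the affordable region, else the
k-padded language would be in BPP); with Shor, exponentially-pinned problems in BQP (ECDLP-type)
give X_B. (ii) PLANTING: hard samplable distributions WITH answers give refuters (the L3 ⇒ L2 step,
e.g. DLOGHalf with sampled exponent, RSA moduli with known factors). (iii) OBSTRUCTION:
worst-case-only, subexponential-per-instance, classically unverifiable hardness defeats both
engines, and an oracle world built from one hidden polylog-size Forrelation/Simon instance per level
plus a PSPACE-complete set plausibly has BQP^A ⊄ BPP^A with NO constructively separable BQP^A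
language — so "S ⇒ X_B" should not relativize for BQP, unlike CJSW's classes.
RANKED CRUXES. rank 2 RefPinnedDichotomy (engine (i), new, provable; fails if the a.e./i.o. and
amplification bookkeeping hides a gap — the refuter must decide padLang-instances of length ≤ n^k+n
and the k-padded inputs must land in the affordable region, both checked on paper). rank 3
RefOracleNonCollapse (∃A: BQP^A ⊄ BPP^A ∧ ¬X_B^A; world (iii); fails if the BBBV extraction
"refuting the canonical P^A-simulator B_Q ⇒ locating a hidden section beyond the brute-force horizon
2^{√(j log n)}" breaks for machines aggregating small query weights over many levels, or if S ⇒ X_B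
relativizes after all; note pinned worlds (full-size Simon) provably do NOT work, by rank 2
relativized). rank 4 RefAutoConstructive (S → X_B: would make the refuter level cost-free; fails
relativizingly if rank 3 holds, and no non-relativizing handle on BQP (complete languages, instance
checkers with classical verifier) is known). rank 5 RefFactConstructive (FACT ∉ BPP → FACT
constructively separated: is the hardness of factoring constructive? fails if worst-case factoring
hardness lives on sparse unsamplable integers: no NP-hardness for GST self-reference, and the
subexponential L[1/3] profile defeats engine (i)).
SUPPORT. RefImmuneWitness (per-language oracle non-collapse: a BQP^A ∖ BPP^A language whose members
cannot be generated; warm-up building the refuter-diagonalization over the tree's Raz–Tal machinery;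
cf. immunity results of Spakowski–Thakur–Tripathi doi:10.1016/j.ic.2004.10.009, wanted acq-02096),
RefPlantedRefuter (engine (ii), one line of Chernoff), RefPadAllMemBQP (BQP closed under
all-paddings, via mem_PromiseBQP_of_polyTimeReducible), RefPinnedAdvantage (glue: (i)+closure ⇒ X_B
from an exponentially pinned BQP language), Target RefThesis, Assembly.
KILL CRITERIA. RefAutoConstructive PROVED ⇒ X_B ≡ S as a theorem: keep the theorem, close the route
as superseded-by-reformulation (its items migrate as support to AvgCase/Shor). RefPinnedDichotomy
REFUTED as typed ⇒ re-type once (the engine is robust on paper); refuted in substance ⇒ close.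
RefOracleNonCollapse proved AND RefPinnedAdvantage's hypothesis shown to need more than S-strength
conjectures nobody believes ⇒ demote to "structure theory only" (dormant). X_B itself is never
staffed for unconditional proof (SeparationPrerequisites).
NOT DECOMPOSED YET. The card's C_witness (KPT/Buss witnessing in APC₁(α): "a feasible proof of S
extracts a refuter") — needs a bounded-arithmetic formalisation of quantum acceptance; deferred
until rank 2–3 settle. Uniform (code-reading, ∃R∀M) refuters over CplxMeta.UniversalMachine;
list- /η-refuters; the negation ¬X_B; ECDLP decision language and its BQP membership (would
instantiate RefPinnedAdvantage; cf. cards curves-are-born-generic, heights-obstruct-index-calculus).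
NOVELTY/BARRIERS: see the dedicated sections (filed with --novelty/ --barriers). Sources:
arXiv:2203.14379, doi:10.1007/s00037-007-0235-8, doi:10.1109/focs57990.2023.00062,
doi:10.1007/s00037-025-00279-2, doi:10.1016/j.ic.2004.10.009, arXiv:quant-ph/9701001,
doi:10.1145/321386.321395, arXiv:1804.00640, arXiv:2204.02063, arXiv:2410.00499,
BernsteinVazirani1997, RazTal2022, Shor1997, BlumMicali1984, BogdanovTrevisan2006.

Novelty: NOVELTY (searched 2026-08-15 before claiming: `lit read arXiv:2203.14379` full text with grep
BQP|quantum|padd|speedup (0 hits for BQP/quantum: CJSW21 never treats quantum classes; Thm 1 scope =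
NP, Σ_k P, PP, ⊕P, PSPACE, EXP, NEXP, EXP^NP; §6 = non-constructive NP languages under NE ≠ E); `lit
search --source crossref` for "constructive separations", "derandomization vs refutation", "immune
sets quantum complexity classes oracle BQP", "Spakowski Thakur Tripathi"; `lit galaxy search
"constructive separation" --star all` (28 rows, all noise); remote S2/OpenAlex/arXiv rate-limited or
down this session (429 / budget / SSL), local searchd reset — the card's own audit
(refuter-novelty-audit 2026-08-15) had already run 'constructive separation BQP', 'refuter quantum
advantage' with no hit; tree: no refuter/constructive-separation notion anywhere under Literature/
or Summits/QuantumAdvantage (grep)).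
Nearest prior art: (1) Chen–Jin–Santhanam–Williams, Constructive separations and their consequences,
FOCS 2021 / TheoretiCS 2024 (arXiv:2203.14379, doi:10.1109/focs52979.2021.00069,
doi:10.46298/theoretics.24.3): Def. 1 (refuters), Thm 1/Thm 4 (automatic constructivisation for
classes closed under poly-bounded quantifiers), §6 (languages with no refuters) — the template; (2)
Gutfreund–Shaltiel–Ta-Shma cc 16 (2007) doi:10.1007/s00037-007-0235-8 and Dolev–Fandina–Gutfreund
2013 (code-reading refuters for NP, NEXP); (3) Chen–Tell–Williams FOCS 2023
doi:10.1109/focs57990.2023.00062 and van  [refs: 10.1109/focs52979.2021.00069, 10.46298/theoretics.24.3, 10.1007/s00037-007-0235-8, 10.1109/focs57990.2023.00062, 10.1007/s00037-025-00279-2, 10.1016/j.ic.2004.10.009, 10.1145/321386.321395, 2203.14379, 1804.00640, 2204.02063, 2410.00499, doi:10.1109/focs52979.2021.00069, doi:10.46298/theoretics.24.3, doi:10.1007/s00037-007-0235-8, doi:10.1109/focs57990.2023.00062, doi:10.1007/s00037-025-00279-2, d]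

Barriers (technique_class: meta-complexity, refuters, relativizing, diagonalization): Literature.Barriers.QuantumAdvantage.SeparationPrerequisites: APPLIES in full to the target — X_B →
S (Assembly) → PP ⊄ BPP, P ≠ PP, P ≠ P^#P, P ≠ PSPACE (SeparationPrerequisites.of_facts with
BQP_subset_PP_holds); NOT evaded: X_B is never staffed for an unconditional proof; the route's
unconditional content is structural (RefPinnedDichotomy, RefPlantedRefuter, RefPadAllMemBQP, the
oracle items) and X_B is reached conditionally (RefPinnedAdvantage: an exponentially pinned BQP
language, e.g. ECDLP-type hardness; RefFactConstructive: Shor's hypothesis).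
Literature.Barriers.QuantumAdvantage.Relativization: [Relativization.not_relativizes_summit_shape /
not_relativizes_either, from exists_oracle_BQPRel_subset_BPPRel_holds and
exists_oracle_BQPRel_not_subset_BPPRel_holds] APPLIES to any proof of X_B (PSPACE-complete A: X_B^A
false with S^A; Forrelation A: both true). For the IMPLICATION S → X_B (RefAutoConstructive) no
catalogued oracle separates the two sides (collapse worlds make it vacuous; the Raz–Tal/Simon worlds
are pinned, so X_B^A holds there by RefPinnedDichotomy relativized) — the route itself files the
missing oracle as RefOracleNonCollapse; if it lands, S → X_B needs non-relativizing technique and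
the catalogue gains an entry ("constructivisation of quantum advantage does not relativize").
RefPinnedDichotomy and RefPlantedRefuter relativize and are consistent with every known world.
Literature.Barriers.QuantumAdvantage.Algebrization: [Algebrization.not_isAlgebrizingSep

History (route lifecycle, newest last):
- 2026-08-16T02:17:40Z · AUTO-CRUX: 1 conjecture-grade item(s) promoted to crux (RefPinnedAdvantage) — refuter vetting / tiering apply (operator:999:1362873)
- 2026-08-16T04:15:13Z · AUTO-CRUX (backfill): RefThesis — hypotheses of the deciding theorem that nothing in the route derives are cruxes (operator:999:1085951)
- 2026-08-22T21:43:40Z · DORMANT — reconciler: no traction for 5.7 d (last activity item-evidence-added at 2026-08-17T04:37:52Z); parked, not closed — `ledger route dormant route-QuantumAdvantage (operator:999:2261728)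

sub-problem: QuantumAdvantage · status: dormant · opened planner-plancard-QuantumAdvantage-QuantumAdva-62ca8273-0 2026-08-15T11:00:25Z · rev 2 · ledger route-QuantumAdvantage-Refuters
GENERATED by the gate from the ledger (D-0016/17). Provers cite these decls: `theorem foo : Summit.QuantumAdvantage.QuantumAdvantage.Theses.Refuters.<Decl> := …` in Summits/QuantumAdvantage/QuantumAdvantage/Theorems/<Name>.lean.
-/

namespace Summit.QuantumAdvantage.QuantumAdvantage.Theses.Refuters

open scoped BigOperators Topology Manifold Classical MeasureTheory ProbabilityTheory Matrix InnerProductSpace ComplexConjugate ContinuousMap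
open Filter Set Function TopologicalSpace MeasureTheory

attribute [summit_statement] _root_.QuantumAdvantage

open Literature.QuantumAdvantage

/-- item stmt-QuantumAdvantage-2034 · crux (kind.auto-crux: conjecture-grade) · rank 0 · open · by planner
why it might fail: X_B ⇒ S ⇒ PP ⊄ BPP, P ≠ PSPACE (SeparationPrerequisites): unconditionally out of reach; false if BQP = BPP; possibly STRICTLY stronger than S — CJSW21 §1.3 exhibits hard languages with no refuters at all, and RefOracleNonCollapse posits a relativized world with S ∧ ¬X_B.
sources: arXiv:2203.14379 Def. 1 (BPP-refuters), Thm 1 (scope NP, Σ_k P, PP, ⊕P, PSPACE, EXP, NEXP, EXP^NP — no BQP), §1.3 (separations that cannot be made constructive), doi:10.1007/s00037-007-0235-8, Literature.Barriers.QuantumAdvantage.SeparationPrerequisites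
[target] Thesis X_B (constructive quantum advantage, level L2): some L ∈ BQP is BPP-constructively
separated from BPP — for every BPP language L'' a PPT refuter R(1^n) outputs, for infinitely many n,
w.p. ≥ 2/3 a length-n string of L Δ L'' (CJSW21 = arXiv:2203.14379 Def. 1, BPP-refuters; refuter may
depend on L''; exact-polynomial coin budget as in mem_BPP_iff_randAlg to exclude advice leaks).
Strictly implies the summit; reached conditionally via RefPinnedAdvantage / RefFactConstructive /
RefPlantedRefuter, structurally calibrated by RefOracleNonCollapse / RefAutoConstructive. -/
@[route_item "route-QuantumAdvantage-Refuters", crux]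
def RefThesis : Prop :=
  ∃ L ∈ Literature.Computability.Cryptography.BQP, ∀ L'' ∈ Literature.Computability.Complexity.BPP, ∃ R : Literature.Computability.Complexity.RandAlg ℕ (List Bool), R.IsPolyTime Computability.unaryEncodeNat id ∧ (∃ q : Polynomial ℕ, ∀ n, R.coinLen n = q.eval n) ∧ ∃ᶠ n in Filter.atTop, (2 : ℝ) / 3 ≤ R.pr Computability.unaryEncodeNat n {x | x.length = n ∧ (x ∈ L ↔ x ∉ L'')}

/-- item stmt-QuantumAdvantage-2037 · crux · rank 3 · open · by planner
why it might fail: Stage bookkeeping may not close: x_{n'} must fool (simulator, refuter) pairs on inputs of length up to 2^{(log n')²/j} that query still-undecided higher levels; the BBBV extraction 'refuter ⇒ poly-query locator' may fail for query weight spread thinly over many levels; false if S ⇒ X_B relativizes.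
sources: arXiv:quant-ph/9701001 Thm 3.3 (BBBV hybrid bound), RazTal2022 App. A; Literature.Computability.QuantumComplexity.exists_oracle_BQPRel_not_subset_BPPRel_holds (OracleSeparationBQPBPP.lean machinery), arXiv:2203.14379 §1.3 / §6 (hard languages with no refuters: R_{K^t} vs constant zero; NP languages under NE ≠ E), doi:10.1016/j.ic.2004.10.009 (immunity/closure for relativized quantum classes; wanted acq-02096)
[crux] RELATIVIZED NON-COLLAPSE of L1 and L2, strong form: an oracle A with BQP^A ⊄ BPP^A but NO
BQP^A language BPP^A-constructively separated (relativized refuters = PPT OracleAdversary with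
output in {0,1}^n). Candidate world (NOTES §C): A = K ⊕ S, K PSPACE-complete, S plants at each level
n ONE Forrelation/Simon instance of size s(n) = log² n at a hidden position x_n ∈ {0,1}^n (other
sections null, planted f(0) ≠ 0). L_A = {x : section x planted of YES type} ∈ BQP^A ∖ BPP^A
(classical query bound 2^{Ω(s)} = n^{Ω(log n)}). For every BQP^A machine Q the deterministic P^A
simulator B_Q (resolve through K every planted section it can locate and afford — levels n' ≤ 2^{√(j
log n)} — treat the rest as null, iterate on heavy sections) errs only where Q puts query weight ≥
1/poly on a planted section beyond that horizon; a refuter hitting such inputs w.p. 2/3 yields by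
BBBV extraction a poly-query locator of x_{n'}, impossible since classical location costs 2^{n'} ≫
every polynomial; choose positions invisible to the finitely many (simulator, refuter, length)
triples per stage as in the tree's Raz–Tal diagonalization (OracleSeparationBQPBPP.lean).
Consequence if proved: CJSW-type automa -/
@[route_item "route-QuantumAdvantage-Refuters"]
def RefOracleNonCollapse : Prop :=
  ∃ A : Language Bool, (∃ L ∈ Literature.Computability.Cryptography.BQPRel A, L ∉ Literature.Computability.Complexity.BPPRel (Literature.Computability.Complexity.Oracle.ofLanguage A)) ∧ ¬ ∃ L ∈ Literature.Computability.Cryptography.BQPRel A, ∀ L'' ∈ Literature.Computability.Complexity.BPPRel (Literature.Computability.Complexity.Oracle.ofLanguage A), ∃ R : Literature.Computability.Cryptography.OracleAdversary (List Bool), R.IsPPT (Computability.encodingList Bool) ∧ ∃ᶠ n in Filter.atTop, (2 : ℝ) / 3 ≤ ((R.outputPMF (Literature.Computability.Complexity.Oracle.ofLanguage A) (Computability.unaryEncodeNat n)).toOuterMeasure {o | ∃ x : List Bool, o = some x ∧ x.length = n ∧ (x ∈ L ↔ x ∉ L'')}).toReal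

/-- item stmt-QuantumAdvantage-2038 · crux · rank 4 · open · by planner
why it might fail: False iff S ∧ ¬X_B, consistent in the conjectured RefOracleNonCollapse world; CJSW21's engine (Thm 1/4: poly-bounded ∃/∀ closure, paddable complete sets; GST search-to-decision) needs NP inside or complete sets — BQP has neither; no classical-verifier instance checker for BQP (Mahadev needs LWE).
sources: arXiv:2203.14379 Thm 1 (scope excludes BQP), Thm 4 (hypotheses), §1.1, §1.3, doi:10.1007/s00037-007-0235-8 (GST: needs NP-completeness of SAT), doi:10.1109/focs57990.2023.00062 (refuters vs derandomization of prBPP), doi:10.1145/3717823.3718216 (Grosser–Carmosino STOC 2025, student-teacher constructive separations / bounded-arithmetic witnessing — pointer only, text not read: paywalled, acq-02738), arXiv:1804.01082 (Mahadev: classical verification of BQP only as an LWE-based argument), doi:10.1145/321386.321395 (Blum speed-up: unpinned languages exist)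
[crux] AUTOMATIC CONSTRUCTIVITY: QuantumAdvantage → X_B (every proof of the summit would come with
refuters, as CJSW21 Thm 1 shows for NP, Σ_k, PP, ⊕P, PSPACE, EXP, NEXP, EXP^NP). CJSW's engine (Thm
4: closure of the hard class under poly-bounded ∃/∀ + paddable complete sets; GST self-reference via
search-to-decision) is unavailable: BQP is not known to contain NP or to have complete
languages/instance checkers with classical verifiers. Partial results available in this route: S ∧
(some witness exponentially pinned) → X_B (RefPinnedAdvantage); S ∧ ¬X_B forces every witness of S
to have an unpinned (speed-up-like, subexponential-in-enumeration) profile. A proof would make the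
refuter level cost-free for the summit; a relativized refutation is RefOracleNonCollapse. -/
@[route_item "route-QuantumAdvantage-Refuters"]
def RefAutoConstructive : Prop :=
  QuantumAdvantage → ∃ L ∈ Literature.Computability.Cryptography.BQP, ∀ L'' ∈ Literature.Computability.Complexity.BPP, ∃ R : Literature.Computability.Complexity.RandAlg ℕ (List Bool), R.IsPolyTime Computability.unaryEncodeNat id ∧ (∃ q : Polynomial ℕ, ∀ n, R.coinLen n = q.eval n) ∧ ∃ᶠ n in Filter.atTop, (2 : ℝ) / 3 ≤ R.pr Computability.unaryEncodeNat n {x | x.length = n ∧ (x ∈ L ↔ x ∉ L'')}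

/-- item stmt-QuantumAdvantage-2039 · crux · rank 5 · open · by planner
why it might fail: Worst-case factoring hardness may sit on sparse integers no PPT process samples WITH answers: FACT ∈ NP ∩ coNP is not NP-hard unless NP = coNP (no GST/CJSW self-reference), factoring is not known random-self-reducible across moduli, and its L[1/3]/L[1/2] profile is not exponentially pinned.
sources: doi:10.1007/s00037-007-0235-8 (self-reference needs NP-completeness), arXiv:2203.14379 Thm 1 (paddable complete languages only), Literature.Computability.QuantumComplexity.FACT_mem_NP_inter_coNP_holds (Factoring.lean / FactoringProofs.lean); FactoringLenstraPomerance.lean (L[1/2] rigorous bound), Shor1997 §5; Literature.Computability.Cryptography.FACT_mem_BQP (named fact, Shor.lean), BogdanovTrevisan2006 Def. 2.12–2.13 (samplable-with-answers vs worst case)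
[crux] IS THE HARDNESS OF FACTORING CONSTRUCTIVE? FACT ∉ BPP (route Shor's hypothesis) → FACT is
BPP-constructively separated: for every BPP language L'' an efficient procedure prints integers
⟨N,k⟩ on which L'' errs. With FACT_mem_BQP this reaches X_B from exactly Shor's hypothesis
(calibration against the flagship conditional route). Known: the PLANTED version (L'' errs
noticeably, i.o., on pq with p,q sampled by R — R knows the answers) is an instance of
RefPlantedRefuter (card's T2); GST/CJSW self-reference needs NP-hardness; the pinning engine needs
an exponential profile but factoring sits at L[1/3] heuristically / L[1/2] rigorously
(FactoringLenstraPomerance.lean). -/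
@[route_item "route-QuantumAdvantage-Refuters"]
def RefFactConstructive : Prop :=
  Literature.Computability.QuantumComplexity.FACT ∉ Literature.Computability.Complexity.BPP → ∀ L'' ∈ Literature.Computability.Complexity.BPP, ∃ R : Literature.Computability.Complexity.RandAlg ℕ (List Bool), R.IsPolyTime Computability.unaryEncodeNat id ∧ (∃ q : Polynomial ℕ, ∀ n, R.coinLen n = q.eval n) ∧ ∃ᶠ n in Filter.atTop, (2 : ℝ) / 3 ≤ R.pr Computability.unaryEncodeNat n {x | x.length = n ∧ (x ∈ Literature.Computability.QuantumComplexity.FACT ↔ x ∉ L'')}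

/-- item stmt-QuantumAdvantage-2043 · crux (kind.auto-crux: conjecture-grade) · rank 9 · open · by planner
why it might fail: auto-crux — conjecture-grade statement (docstring avows it ('conjectured')); it is open, so it may simply be false
sources: RefPinnedDichotomy, RefPadAllMemBQP, Shor1997 §6, BlumMicali1984
[support] GLUE: an exponentially pinned BQP language gives X_B — from RefPinnedDichotomy (refuters
for L^all) and RefPadAllMemBQP (L^all ∈ BQP). Intended instantiation (not filed yet): a
Blum–Micali-type half-predicate for ELLIPTIC-CURVE discrete logarithms — brute force 2^{O(n)}
deterministic, conjectured to need 2^{δn} randomized time (generic-group/ECC assumption), in BQP by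
Shor/Proos–Zalka — so that 'ECDLP is exponentially hard' ⇒ X_B; factoring/finite-field DLOG do NOT
qualify (subexponential index calculus). -/
@[route_item "route-QuantumAdvantage-Refuters"]
def RefPinnedAdvantage : Prop :=
  (∃ L ∈ Literature.Computability.Cryptography.BQP, ∃ a k : ℕ, 1 ≤ a ∧ 1 ≤ k ∧ Literature.Computability.Complexity.padLang a L ∈ Literature.Computability.Complexity.BPP ∧ {w : List Bool | ∃ x ∈ L, w = List.replicate (2 ^ ((x.length ^ a + k - 1) / k)) true ++ false :: x} ∉ Literature.Computability.Complexity.BPP) → ∃ L ∈ Literature.Computability.Cryptography.BQP, ∀ L'' ∈ Literature.Computability.Complexity.BPP, ∃ R : Literature.Computability.Complexity.RandAlg ℕ (List Bool), R.IsPolyTime Computability.unaryEncodeNat id ∧ (∃ q : Polynomial ℕ, ∀ n, R.coinLen n = q.eval n) ∧ ∃ᶠ n in Filter.atTop, (2 : ℝ) / 3 ≤ R.pr Computability.unaryEncodeNat n {x | x.length = n ∧ (x ∈ L ↔ x ∉ L'')}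

/-- item stmt-QuantumAdvantage-2036 · support · rank 2 · open · by planner
why it might fail: Bookkeeping risk only if the paper proof hides a gap: the refuter must decide padLang-instances of length ≤ n^k+n inside poly(n), the k-padded inputs must land in the affordable region (checked: n^k ≥ 2^{k⌈m^a/k⌉}), and BPP must be closed under finite patching ∩ P-format.
sources: AroraBarak2009 §2.6.2 (padding/translation), arXiv:2203.14379 Thm 4 (padding step), §5, Literature.Computability.Complexity.padLang / expPad (ExpPadding.lean, Murray–Williams 2017 Thm 4.1 pad), Literature.Computability.Complexity.exists_randAlg_error_le_two_pow_of_mem_BPP (BPPErrorReductionStrong.lean, proved), Literature.Computability.Complexity.PolyTimeComputable.comp_holds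
[crux] PINNING DICHOTOMY (engine of the route; new, provable by padding/translation): if L has
randomized complexity 2^{Θ(n^a)} — upper bound `padLang a L ∈ BPP` (pad 1^{2^{m^a}} 0 x, tree
ExpPadding.lean), lower bound `{1^{2^{⌈m^a/k⌉}} 0 x : x ∈ L} ∉ BPP` — then the all-paddings language
L^all = {1^t 0 x : x ∈ L, t ≥ 0} is BPP-constructively separated. Proof: given L'' ∈ BPP let E =
formatted w = 1^t 0 x with 2^{|x|^a} ≤ |w|^k and w ∈ L^all Δ L''. If E meets infinitely many
lengths, R(1^n) enumerates all x with 2^{|x|^a} ≤ n^k (≤ n·n^k candidates since a ≥ 1 gives 2^{|x|}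
≤ n^k), decides x ∈ L by the padLang machine on inputs of length ≤ n^k + n and w ∈ L'' by its
machine, both amplified to error 2^{-2n} (exists_randAlg_error_le_of_mem_BPP_holds), and outputs the
first disagreement: success → 1 at every such n. Else E is finite, and every k-padded input lies in
the region (n^k ≥ 2^{k⌈m^a/k⌉} ≥ 2^{m^a}), so the k-padded language equals L'' on its P-decidable
format up to finitely many strings, hence is in BPP — contradiction. Covers exponential profiles
only (a ≥ 1: the enumeration 2^m must be affordable wherever checking is); subexponential profiles
(factoring, quasi-poly) are del -/
@[route_item "route-QuantumAdvantage-Refuters"]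
def RefPinnedDichotomy : Prop :=
  ∀ (L : Language Bool) (a k : ℕ), 1 ≤ a → 1 ≤ k → Literature.Computability.Complexity.padLang a L ∈ Literature.Computability.Complexity.BPP → {w : List Bool | ∃ x ∈ L, w = List.replicate (2 ^ ((x.length ^ a + k - 1) / k)) true ++ false :: x} ∉ Literature.Computability.Complexity.BPP → ∀ L'' ∈ Literature.Computability.Complexity.BPP, ∃ R : Literature.Computability.Complexity.RandAlg ℕ (List Bool), R.IsPolyTime Computability.unaryEncodeNat id ∧ (∃ q : Polynomial ℕ, ∀ n, R.coinLen n = q.eval n) ∧ ∃ᶠ n in Filter.atTop, (2 : ℝ) / 3 ≤ R.pr Computability.unaryEncodeNat n {w | w.length = n ∧ (w ∈ {v : List Bool | ∃ t : ℕ, ∃ x ∈ L, v = List.replicate t true ++ false :: x} ↔ w ∉ L'')}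

/-- item stmt-QuantumAdvantage-2040 · support · rank 9 · open · by planner
sources: Literature.Computability.QuantumComplexity.exists_oracle_BQPRel_not_subset_BPPRel_holds, doi:10.1016/j.ic.2004.10.009, doi:10.1007/bf01699457
[support] PER-LANGUAGE NON-COLLAPSE (warm-up for RefOracleNonCollapse; immunity-type witness): an
oracle A and L ∈ BQP^A ∖ BPP^A whose members cannot be generated — no PPT oracle machine outputs,
for infinitely many n, w.p. ≥ 2/3 an element of L of length n (so the empty language is an
irrefutable BPP^A 'algorithm' for L and L is not constructively separated). Construction: the tree's
Raz–Tal/Forrelation diagonalization (OracleSeparationBQPBPP.lean) with the level-n window planted at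
a hidden index x ∈ {0,1}^n instead of at 1^n, positions chosen outside the poly-size probe/output
mass of the finitely many refuters handled at that stage (2^n ≫ poly), types chosen against the
stage's BPP description. Nearest print: immunity/closure results for quantum classes,
Spakowski–Thakur–Tripathi 2005 (doi:10.1016/j.ic.2004.10.009, wanted acq-02096); Balcázar–Schöning
bi-immunity (doi:10.1007/bf01699457). -/
@[route_item "route-QuantumAdvantage-Refuters"]
def RefImmuneWitness : Prop :=
  ∃ A : Language Bool, ∃ L ∈ Literature.Computability.Cryptography.BQPRel A, L ∉ Literature.Computability.Complexity.BPPRel (Literature.Computability.Complexity.Oracle.ofLanguage A) ∧ ∀ R : Literature.Computability.Cryptography.OracleAdversary (List Bool), R.IsPPT (Computability.encodingList Bool) → ¬ ∃ᶠ n in Filter.atTop, (2 : ℝ) / 3 ≤ ((R.outputPMF (Literature.Computability.Complexity.Oracle.ofLanguage A) (Computability.unaryEncodeNat n)).toOuterMeasure {o | ∃ x ∈ L, o = some x ∧ x.length = n}).toReal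

/-- item stmt-QuantumAdvantage-2041 · support · rank 9 · open · by planner
sources: arXiv:2203.14379 Def. 1 and footnote, Def. 4 (list-refuters), BlumMicali1984 §3, BogdanovTrevisan2006 Def. 2.12-2.13, Summit.QuantumAdvantage.QuantumAdvantage.Theses.AvgCase.AvgDlogHalf
[support] PLANTING ENGINE (the exact L3 ⇒ L2 bridge to route AvgCase): if a PPT sampler S(1^n)
outputs pairs (x, [x ∈ L]) with |x| = n (samplable WITH answers: DLOGHalf with sampled exponent a
and y = g^a, BlumMicali1984; RSA moduli with known factors) and every BPP language L'' disagrees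
with L on S's marginal with probability ≥ 1/(n^c+1) for infinitely many n, then L is
BPP-constructively separated: R draws O(n^{c+1}) samples, decides L'' on each (amplified), compares
with the supplied bit, outputs the first disagreement (Chernoff; success → 1 i.o.). Without answers
(plain (L,D) ∉ HeurBPP) only list- /η-refuters follow (CJSW21 fn. to Def. 1: 2/3 is not amplifiable)
— recorded, not filed. -/
@[route_item "route-QuantumAdvantage-Refuters"]
def RefPlantedRefuter : Prop :=
  ∀ (L : Language Bool) (S : Literature.Computability.Complexity.RandAlg ℕ (List Bool × Bool)), S.IsPolyTime Computability.unaryEncodeNat (fun p : List Bool × Bool => Literature.Computability.Complexity.boolPair p.1 (Computability.encodeBool p.2)) → (∃ q : Polynomial ℕ, ∀ n, S.coinLen n = q.eval n) → (∀ n, S.pr Computability.unaryEncodeNat n {p | p.1.length = n ∧ (p.2 = true ↔ p.1 ∈ L)} = 1) → (∀ L'' ∈ Literature.Computability.Complexity.BPP, ∃ c : ℕ, ∃ᶠ n : ℕ in Filter.atTop, (1 : ℝ) / ((n : ℝ) ^ c + 1) ≤ S.pr Computability.unaryEncodeNat n {p | p.1 ∈ L ↔ p.1 ∉ L''}) → ∀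 L'' ∈ Literature.Computability.Complexity.BPP, ∃ R : Literature.Computability.Complexity.RandAlg ℕ (List Bool), R.IsPolyTime Computability.unaryEncodeNat id ∧ (∃ q : Polynomial ℕ, ∀ n, R.coinLen n = q.eval n) ∧ ∃ᶠ n in Filter.atTop, (2 : ℝ) / 3 ≤ R.pr Computability.unaryEncodeNat n {x | x.length = n ∧ (x ∈ L ↔ x ∉ L'')}

/-- item stmt-QuantumAdvantage-2042 · support · rank 9 · open · by planner
sources: Literature.Computability.Cryptography.mem_PromiseBQP_of_polyTimeReducible, Literature.Computability.Cryptography.ofLanguage_mem_PromiseBQP_iff, Literature.Computability.Cryptography.P_subset_BQP_holds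
[support] BQP is closed under the all-paddings construction L ↦ {1^t 0 x : x ∈ L}: Karp-reduce to L
by stripping the pad (map pad-free strings 1^n to a fixed non-member; if L = univ the padded
language is in P ⊆ BQP, P_subset_BQP_holds) and use mem_PromiseBQP_of_polyTimeReducible with
ofLanguage_mem_PromiseBQP_iff (both proved, ClassBQPReductionProofs.lean / ClassBQP.lean). Glue for
RefPinnedAdvantage. -/
@[route_item "route-QuantumAdvantage-Refuters"]
def RefPadAllMemBQP : Prop :=
  ∀ L ∈ Literature.Computability.Cryptography.BQP, {v : List Bool | ∃ t : ℕ, ∃ x ∈ L, v = List.replicate t true ++ false :: x} ∈ Literature.Computability.Cryptography.BQP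

/-- item stmt-QuantumAdvantage-2035 · assembly · rank 1 · open · by planner
[assembly] X_B → QuantumAdvantage: if the witness L were in BPP, take L'' := L; a refuter would
output an element of L Δ L = ∅ with probability ≥ 2/3. One line (proved as a sanity check in the
planner's sketch: rintro, pr of the empty event is 0). -/
@[route_item "route-QuantumAdvantage-Refuters"]
def Assembly : Prop :=
  (∃ L ∈ Literature.Computability.Cryptography.BQP, ∀ L'' ∈ Literature.Computability.Complexity.BPP, ∃ R : Literature.Computability.Complexity.RandAlg ℕ (List Bool), R.IsPolyTime Computability.unaryEncodeNat id ∧ (∃ q : Polynomial ℕ, ∀ n, R.coinLen n = q.eval n) ∧ ∃ᶠ n in Filter.atTop, (2 : ℝ) / 3 ≤ R.pr Computability.unaryEncodeNat n {x | x.length = n ∧ (x ∈ L ↔ x ∉ L'')}) → QuantumAdvantage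

/-! D-0027 §2.1 — DECIDING THEOREM (planner-authored via `route open/edit --closes-file`; by planner-rbadge-QuantumAdvantage-Refuters-81381c79-g2-0 2026-08-15T16:14:43Z):
its hypotheses are this route's items and its conclusion the sub-problem Statement (glue_lint), and it elaborates with this file. -/

@[closes "route-QuantumAdvantage-Refuters"] theorem closes (h₁ : RefThesis) : _root_.QuantumAdvantage := by
  -- It suffices to show X_B (RefThesis): take its witness L ∈ BQP; if L were in BPP, the refuter
  -- against L'' := L would output, for some n, an element of {x | |x| = n ∧ (x ∈ L ↔ x ∉ L)} = ∅
  -- with probability ≥ 2/3, but the probability of the empty event is 0.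
  obtain ⟨L, hLBQP, hL⟩ := h₁
  refine ⟨L, hLBQP, fun hLBPP => ?_⟩
  obtain ⟨R, -, -, hfreq⟩ := hL L hLBPP
  obtain ⟨n, hn⟩ := hfreq.exists
  have h0 : R.pr Computability.unaryEncodeNat n
      {x : List Bool | x.length = n ∧ (x ∈ L ↔ x ∉ L)} = 0 := by
    simp [Literature.Computability.Complexity.RandAlg.pr]
  rw [h0] at hn
  norm_num at hn

end Summit.QuantumAdvantage.QuantumAdvantage.Theses.Refuters
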